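import Summits.BirchSwinnertonDyer.BirchSwinnertonDyer.Theorems.ResidualThetaTransportAtTwoThetaLayerLambdaCongruenceAtTwoPeriodFactor
import HarnessLib

/-!
# Crux `ThetaLayerLambdaCongruenceAtTwo` (stmt-BirchSwinnertonDyer-20688, route ResidualThetaTransportAtTwo), line
# `birth` v13 — SD floor, brick S4 (part 2): the dual graph of the Farey tessellation is a TREE — a closed dual chain
# crosses every Farey edge with net multiplicity zero (width seat bsd-wall-rtt-p3-w2 g8;
# `--supports stmt-BirchSwinnertonDyer-20688 --as helper`; closes nothing)

HONEST FRAMING. Elementary THEOREMS about `2×2` integer matrices of determinant `1` and lists of them; no definition; nothing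
about any curve or form is asserted; BSD is not proved by any of this.

WHAT. A CLOSED dual chain is a list `W` of matrices with `Σ_{h∈W} (G(h) − G(hS)) = 0` for every triangle function `G`
(`G(gτ) = G(g)`, `τ = ST⁻¹`; `G(−g) = G(g)`), cf. `…DualChain`: a closed walk in the dual graph of the Farey tessellation (vertices =
Farey triangles `g·{∞,0,1}`, edges = Farey edges `{g∞, g0}`), each `h` being the step across `{h∞, h0}` from the triangle of `hS` to
that of `h`. THEOREM `dualChain_closed_netCrossing_eq_zero`: for every `g ∈ SL₂(ℤ)`, the NET number of crossings of the oriented edge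
of `g` vanishes: `Σ_{h∈W} ([h = ±g] − [hS = ±g]) = 0`. This is the acyclicity of the dual graph (Serre: `SL₂(ℤ)` acts on a tree), proved
here by a SIDE FUNCTION: §1 Farey neighbours never separate `0` from `∞` strictly (`|ad − bc| = 1 ⇒ ¬(ac < 0 < bd)`,
`farey_not_opposite_signs`); §2 the indicator `G₁(m) = [m₀₀m₁₀ > 0 ∨ m₀₁m₁₁ > 0 ∨ (m₀₀+m₀₁)(m₁₀+m₁₁) > 0]` of «the triangle of `m`
lies on the positive side of the edge `{∞, 0}`» is a triangle function (`side_mul_tau`, `side_neg`) whose jump across an edge is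
exactly the oriented indicator of the edge `{∞,0}`: `G₁(m) − G₁(mS) = [m = ±1] − [mS = ±1]` (`side_jump_int`, `side_sub_side_mul_S`); §3 telescoping
with `G = G₁(g⁻¹·)`. Consequence (next file): the signed crossing VECTOR on `SL₂(ℤ)/Γ₀(N)` of a closed dual chain vanishes, so the
crossing vector of a dual chain of `γ ∈ Γ₀(N)` (`…DualChain`) does not depend on the chain and is additive in `γ` — the bridge `θ`
of `Cruxes/…/Lines/birth-sd2-architecture.md`.

References: J.-P. Serre, Trees, §I.4.2 (`SL₂(ℤ)` and its tree); [Manin1972] §1.5; [CremonaAlgorithms1997] §2.2 (M-symbols and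
Farey neighbours).
-/

set_option autoImplicit false

noncomputable section

-- justification: the `Summit.BirchSwinnertonDyer.BirchSwinnertonDyer.…` path repeats a component (route-file convention)
set_option linter.dupNamespace false

open scoped Classical MatrixGroups

open CongruenceSubgroup Matrix.SpecialLinearGroup ModularGroup
open Literature.NumberTheory.EllipticCurves.ModularForms

namespace Summit.BirchSwinnertonDyer.BirchSwinnertonDyer.Theorems.ThetaLayerLambdaCongruenceAtTwo

/-! ## §1. Farey neighbours do not separate `0` from `∞` -/

section Farey

/-- **Farey neighbours never have opposite strict signs**: if `|ad − bc| = 1` then it is impossible that `a/c < 0 < b/d` strictly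
(`ac < 0 < bd`): the products `ad`, `bc` would be non-zero of opposite signs, forcing `|ad − bc| ≥ 2`. Geometrically: the Farey edge
`{a/c, b/d}` does not cross the edge `{0, ∞}`. [cite: CremonaAlgorithms1997, §2.2] -/
theorem farey_not_opposite_signs (a b c d : ℤ) (hdet : a * d - b * c = 1 ∨ a * d - b * c = -1) :
    ¬ (a * c < 0 ∧ 0 < b * d) := by
  rintro ⟨h1, h2⟩
  have hprod : (a * d) * (b * c) < 0 := by
    have : (a * d) * (b * c) = (a * c) * (b * d) := by ring
    rw [this]
    exact mul_neg_of_neg_of_pos h1 h2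
  rcases hdet with h | h <;> nlinarith [sq_nonneg (a * d + b * c), sq_nonneg (a * d), sq_nonneg (b * c)]

/-- The symmetric statement: `¬ (0 < ac ∧ bd < 0)`. [cite: CremonaAlgorithms1997, §2.2] -/
theorem farey_not_opposite_signs' (a b c d : ℤ) (hdet : a * d - b * c = 1 ∨ a * d - b * c = -1) :
    ¬ (0 < a * c ∧ b * d < 0) := by
  rintro ⟨h1, h2⟩
  have hprod : (a * d) * (b * c) < 0 := by
    have : (a * d) * (b * c) = (a * c) * (b * d) := by ring
    rw [this]
    exact mul_neg_of_pos_of_neg h1 h2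
  rcases hdet with h | h <;> nlinarith [sq_nonneg (a * d + b * c), sq_nonneg (a * d), sq_nonneg (b * c)]

end Farey

/-! ## §2. The side function of the edge `{∞, 0}` -/

section Side

/-- `S T⁻¹ = (0,−1;1,−1)` (`= τ`). [folklore] -/
theorem S_mul_T_inv_eq : (S * T⁻¹ : SL(2, ℤ)) = ⟨!![0, -1; 1, -1], by norm_num [Matrix.det_fin_two_of]⟩ := by
  apply Subtype.ext
  rw [coe_mul, coe_S, coe_T_inv]
  ext i j
  fin_cases i <;> fin_cases j <;> simp [Matrix.mul_apply, Fin.sum_univ_two]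

/-- Entries of `mτ`: `(b, −(a+b); d, −(c+d))`. [folklore] -/
theorem mul_tau_apply (m : SL(2, ℤ)) :
    (m * (S * T⁻¹)) 0 0 = m 0 1 ∧ (m * (S * T⁻¹)) 0 1 = -(m 0 0 + m 0 1) ∧
    (m * (S * T⁻¹)) 1 0 = m 1 1 ∧ (m * (S * T⁻¹)) 1 1 = -(m 1 0 + m 1 1) := by
  have e := Matrix.two_mul_expl (m : Matrix (Fin 2) (Fin 2) ℤ) ((S * T⁻¹ : SL(2, ℤ)) : Matrix (Fin 2) (Fin 2) ℤ)
  rw [S_mul_T_inv_eq] at e ⊢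
  refine ⟨e.1.trans ?_, e.2.1.trans ?_, e.2.2.1.trans ?_, e.2.2.2.trans ?_⟩ <;> simp <;> ring

/-- Entries of `mS`: `(b, −a; d, −c)`. [folklore] -/
theorem mul_S_apply (m : SL(2, ℤ)) :
    (m * S) 0 0 = m 0 1 ∧ (m * S) 0 1 = -m 0 0 ∧ (m * S) 1 0 = m 1 1 ∧ (m * S) 1 1 = -m 1 0 := by
  have e := Matrix.two_mul_expl (m : Matrix (Fin 2) (Fin 2) ℤ) ((S : SL(2, ℤ)) : Matrix (Fin 2) (Fin 2) ℤ)
  refine ⟨e.1.trans ?_, e.2.1.trans ?_, e.2.2.1.trans ?_, e.2.2.2.trans ?_⟩ <;> simp [coe_S]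

/-- **The side function is a triangle function (τ-invariance)**: the three vertex products `m₀₀m₁₀, m₀₁m₁₁, (m₀₀+m₀₁)(m₁₀+m₁₁)`
(signs of the vertices `m∞, m0, m1` of the triangle of `m`) are permuted cyclically by `m ↦ mτ`. [folklore] -/
theorem side_mul_tau (m : SL(2, ℤ)) :
    (if (0 < (m * (S * T⁻¹)) 0 0 * (m * (S * T⁻¹)) 1 0 ∨ 0 < (m * (S * T⁻¹)) 0 1 * (m * (S * T⁻¹)) 1 1 ∨
        0 < ((m * (S * T⁻¹)) 0 0 + (m * (S * T⁻¹)) 0 1) * ((m * (S * T⁻¹)) 1 0 + (m * (S * T⁻¹)) 1 1)) then (1 : ℤ) else 0) =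
    (if (0 < m 0 0 * m 1 0 ∨ 0 < m 0 1 * m 1 1 ∨ 0 < (m 0 0 + m 0 1) * (m 1 0 + m 1 1)) then (1 : ℤ) else 0) := by
  obtain ⟨e00, e01, e10, e11⟩ := mul_tau_apply m
  rw [e00, e01, e10, e11]
  have e3 : (m 0 1 + -(m 0 0 + m 0 1)) * (m 1 1 + -(m 1 0 + m 1 1)) = m 0 0 * m 1 0 := by ring
  have e2 : -(m 0 0 + m 0 1) * -(m 1 0 + m 1 1) = (m 0 0 + m 0 1) * (m 1 0 + m 1 1) := by ring
  rw [e3, e2]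
  exact if_congr ⟨fun h ↦ h.elim (fun h ↦ Or.inr (Or.inl h)) fun h ↦ h.elim (fun h ↦ Or.inr (Or.inr h)) fun h ↦ Or.inl h,
    fun h ↦ h.elim (fun h ↦ Or.inr (Or.inr h)) fun h ↦ h.elim (fun h ↦ Or.inl h) fun h ↦ Or.inr (Or.inl h)⟩ rfl rfl

/-- **Sign invariance** of the side function. [folklore] -/
theorem side_neg (m : SL(2, ℤ)) :
    (if (0 < (-m) 0 0 * (-m) 1 0 ∨ 0 < (-m) 0 1 * (-m) 1 1 ∨ 0 < ((-m) 0 0 + (-m) 0 1) * ((-m) 1 0 + (-m) 1 1)) then (1 : ℤ)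
      else 0) =
    (if (0 < m 0 0 * m 1 0 ∨ 0 < m 0 1 * m 1 1 ∨ 0 < (m 0 0 + m 0 1) * (m 1 0 + m 1 1)) then (1 : ℤ) else 0) := by
  have e : ∀ i j, (-m) i j = -m i j := fun i j ↦ by simp
  simp only [e, neg_mul_neg, ← neg_add]

/-- **The jump of the side function, in coordinates.** For integers with `ad − bc = 1`:
`G₁(a,b,c,d) − G₁(b,−a,d,−c) = [b = c = 0] − [a = d = 0]` (the matrix `(a b; c d)` is `±1` iff `b = c = 0`, and `(a b; c d)·S = ±1`
iff `a = d = 0`). The generic case is `farey_not_opposite_signs` for the Farey pairs `(a/c, (a±b)/(c±d))`, `(b/d, (a±b)/(c±d))`.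
[cite: CremonaAlgorithms1997, §2.2] -/
theorem side_jump_int (a b c d : ℤ) (hdet : a * d - b * c = 1) :
    (if (0 < a * c ∨ 0 < b * d ∨ 0 < (a + b) * (c + d)) then (1 : ℤ) else 0) -
      (if (0 < b * d ∨ 0 < a * c ∨ 0 < (a - b) * (c - d)) then (1 : ℤ) else 0) =
    (if (b = 0 ∧ c = 0) then (1 : ℤ) else 0) - (if (a = 0 ∧ d = 0) then (1 : ℤ) else 0) := by
  by_cases h1 : b = 0 ∧ c = 0
  · -- `m = ±1`
    obtain ⟨rfl, rfl⟩ := h1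
    have had : a * d = 1 := by linarith
    have ha0 : a ≠ 0 := left_ne_zero_of_mul_eq_one had
    have e1 : (a + 0) * (0 + d) = 1 := by rw [add_zero, zero_add, had]
    have e2 : (a - 0) * (0 - d) = -1 := by rw [sub_zero, zero_sub, mul_neg, had]
    rw [e1, e2, mul_zero, zero_mul]
    simp [ha0]
  · by_cases h2 : a = 0 ∧ d = 0
    · -- `m = ±S`
      obtain ⟨rfl, rfl⟩ := h2
      have hbc : b * c = -1 := by linarith
      have hb0 : b ≠ 0 := by rintro rfl; simp at hbc
      have e1 : (0 + b) * (c + 0) = -1 := by rw [zero_add, add_zero, hbc]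
      have e2 : (0 - b) * (c - 0) = 1 := by rw [zero_sub, sub_zero, neg_mul, hbc, neg_neg]
      rw [e1, e2, mul_zero, zero_mul]
      simp [hb0]
    · rw [if_neg h1, if_neg h2, sub_self]
      by_cases hpos : 0 < a * c ∨ 0 < b * d
      · rw [if_pos (hpos.elim Or.inl fun h ↦ Or.inr (Or.inl h)), if_pos (hpos.elim (fun h ↦ Or.inr (Or.inl h)) Or.inl),
          sub_self]
      · have hac : ¬ 0 < a * c := fun h ↦ hpos (Or.inl h)
        have hbd : ¬ 0 < b * d := fun h ↦ hpos (Or.inr h)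
        -- not both products vanish (else `m ∈ {±1, ±S}`), so one is strictly negative
        have hstrict : a * c < 0 ∨ b * d < 0 := by
          by_contra hcon
          have hac0 : a * c = 0 := le_antisymm (not_lt.mp hac) (not_lt.mp fun h ↦ hcon (Or.inl h))
          have hbd0 : b * d = 0 := le_antisymm (not_lt.mp hbd) (not_lt.mp fun h ↦ hcon (Or.inr h))
          rcases mul_eq_zero.mp hac0 with ha0 | hc0
          · have hbc : b * c = -1 := by rw [ha0, zero_mul, zero_sub] at hdet; linarith
            have hb0 : b ≠ 0 := by rintro rfl; simp at hbc
            exact h2 ⟨ha0, (mul_eq_zero.mp hbd0).resolve_left hb0⟩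
          · have had : a * d = 1 := by rw [hc0, mul_zero, sub_zero] at hdet; exact hdet
            have hd0 : d ≠ 0 := right_ne_zero_of_mul_eq_one had
            exact h1 ⟨(mul_eq_zero.mp hbd0).resolve_right hd0, hc0⟩
        -- the third vertices `(a±b)/(c±d)` are Farey neighbours of `a/c` and of `b/d`
        have hsum : ¬ 0 < (a + b) * (c + d) := by
          intro hlt
          rcases hstrict with hac' | hbd'
          · exact farey_not_opposite_signs a (a + b) c (c + d) (Or.inl (by linear_combination hdet)) ⟨hac', hlt⟩
          · exact farey_not_opposite_signs b (a + b) d (c + d) (Or.inr (by linear_combination -hdet)) ⟨hbd', hlt⟩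
        have hdiff : ¬ 0 < (a - b) * (c - d) := by
          intro hlt
          rcases hstrict with hac' | hbd'
          · exact farey_not_opposite_signs a (a - b) c (c - d) (Or.inr (by linear_combination -hdet)) ⟨hac', hlt⟩
          · exact farey_not_opposite_signs b (a - b) d (c - d) (Or.inr (by linear_combination -hdet)) ⟨hbd', hlt⟩
        rw [if_neg (by tauto), if_neg (by tauto), sub_self]

/-- `m = ±1` iff its off-diagonal entries vanish (given `det m = 1`). [folklore] -/
theorem eq_one_or_eq_neg_one_iff (m : SL(2, ℤ)) : (m = 1 ∨ m = -1) ↔ (m 0 1 = 0 ∧ m 1 0 = 0) := by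
  constructor
  · rintro (rfl | rfl) <;> simp
  · rintro ⟨hb0, hc0⟩
    have hdet : m 0 0 * m 1 1 - m 0 1 * m 1 0 = 1 := by
      have := Matrix.det_fin_two m.1
      rw [m.2] at this
      linear_combination -this
    have had : m 0 0 * m 1 1 = 1 := by rw [hb0, zero_mul, sub_zero] at hdet; exact hdet
    rcases Int.eq_one_or_neg_one_of_mul_eq_one had with ha1 | ha1
    · have hd1 : m 1 1 = 1 := by rw [ha1, one_mul] at had; exact had
      left; ext i j; fin_cases i <;> fin_cases j <;> simp [ha1, hb0, hc0, hd1]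
    · have hd1 : m 1 1 = -1 := by rw [ha1] at had; linarith
      right; ext i j; fin_cases i <;> fin_cases j <;> simp [ha1, hb0, hc0, hd1]

/-- `mS = ±1` iff the diagonal entries of `m` vanish (given `det m = 1`; then `m = ∓S`). [folklore] -/
theorem mul_S_eq_one_or_eq_neg_one_iff (m : SL(2, ℤ)) : (m * S = 1 ∨ m * S = -1) ↔ (m 0 0 = 0 ∧ m 1 1 = 0) := by
  rw [eq_one_or_eq_neg_one_iff, (mul_S_apply m).2.1, (mul_S_apply m).2.2.1, neg_eq_zero]

/-- **The jump of the side function across an edge is the oriented indicator of the edge `{∞, 0}`**: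
`G₁(m) − G₁(mS) = [m = ±1] − [mS = ±1]`. [cite: CremonaAlgorithms1997, §2.2] -/
theorem side_sub_side_mul_S (m : SL(2, ℤ)) :
    (if (0 < m 0 0 * m 1 0 ∨ 0 < m 0 1 * m 1 1 ∨ 0 < (m 0 0 + m 0 1) * (m 1 0 + m 1 1)) then (1 : ℤ) else 0) -
    (if (0 < (m * S) 0 0 * (m * S) 1 0 ∨ 0 < (m * S) 0 1 * (m * S) 1 1 ∨
        0 < ((m * S) 0 0 + (m * S) 0 1) * ((m * S) 1 0 + (m * S) 1 1)) then (1 : ℤ) else 0) =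
    (if (m = 1 ∨ m = -1) then (1 : ℤ) else 0) - (if (m * S = 1 ∨ m * S = -1) then (1 : ℤ) else 0) := by
  obtain ⟨s00, s01, s10, s11⟩ := mul_S_apply m
  have hdet : m 0 0 * m 1 1 - m 0 1 * m 1 0 = 1 := by
    have := Matrix.det_fin_two m.1
    rw [m.2] at this
    linear_combination -this
  rw [s00, s01, s10, s11, neg_mul_neg,
    show (m 0 1 + -m 0 0) * (m 1 1 + -m 1 0) = (m 0 0 - m 0 1) * (m 1 0 - m 1 1) by ring,
    if_congr (eq_one_or_eq_neg_one_iff m) rfl rfl, if_congr (mul_S_eq_one_or_eq_neg_one_iff m) rfl rfl]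
  exact side_jump_int (m 0 0) (m 0 1) (m 1 0) (m 1 1) hdet

end Side

/-! ## §3. Closed dual chains have net crossing number zero with every edge -/

section Acyclic

/-- **The dual graph of the Farey tessellation is a tree (net-crossing form).** For a CLOSED dual chain `W`
(`Σ_{h∈W} (G h − G(hS)) = 0` for every `τ`- and sign-invariant `G`) and every `g ∈ SL₂(ℤ)`:
`Σ_{h∈W} ([h = ±g] − [hS = ±g]) = 0` — the walk crosses the oriented edge of `g` as often forwards as backwards. (Telescoping with
the side function of the edge of `g`, `h ↦ G₁(g⁻¹h)`.) [cite: Manin1972, §1.5] -/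
theorem dualChain_closed_netCrossing_eq_zero (W : List SL(2, ℤ))
    (hW : ∀ {A : Type} [AddCommGroup A] (G : SL(2, ℤ) → A),
      (∀ x, G (x * (S * T⁻¹)) = G x) → (∀ x, G (-x) = G x) → (W.map fun h ↦ G h - G (h * S)).sum = 0)
    (g : SL(2, ℤ)) :
    (W.map fun h ↦ (if (h = g ∨ h = -g) then (1 : ℤ) else 0) - (if (h * S = g ∨ h * S = -g) then (1 : ℤ) else 0)).sum = 0 := by
  let G : SL(2, ℤ) → ℤ := fun h ↦
    if (0 < (g⁻¹ * h) 0 0 * (g⁻¹ * h) 1 0 ∨ 0 < (g⁻¹ * h) 0 1 * (g⁻¹ * h) 1 1 ∨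
      0 < ((g⁻¹ * h) 0 0 + (g⁻¹ * h) 0 1) * ((g⁻¹ * h) 1 0 + (g⁻¹ * h) 1 1)) then 1 else 0
  have hGdef : ∀ h, G h = if (0 < (g⁻¹ * h) 0 0 * (g⁻¹ * h) 1 0 ∨ 0 < (g⁻¹ * h) 0 1 * (g⁻¹ * h) 1 1 ∨
      0 < ((g⁻¹ * h) 0 0 + (g⁻¹ * h) 0 1) * ((g⁻¹ * h) 1 0 + (g⁻¹ * h) 1 1)) then 1 else 0 := fun h ↦ rfl
  have hτ : ∀ x, G (x * (S * T⁻¹)) = G x := fun x ↦ by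
    rw [hGdef, hGdef, ← mul_assoc]
    exact side_mul_tau (g⁻¹ * x)
  have hneg : ∀ x, G (-x) = G x := fun x ↦ by
    rw [hGdef, hGdef, mul_neg]
    exact side_neg (g⁻¹ * x)
  have key := hW G hτ hneg
  have e : (W.map fun h ↦ (if (h = g ∨ h = -g) then (1 : ℤ) else 0) - (if (h * S = g ∨ h * S = -g) then (1 : ℤ) else 0)) =
      W.map fun h ↦ G h - G (h * S) := by
    refine List.map_congr_left fun h _ ↦ ?_
    have e1 : (g⁻¹ * h = 1 ∨ g⁻¹ * h = -1) ↔ (h = g ∨ h = -g) := by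
      rw [inv_mul_eq_one, inv_mul_eq_iff_eq_mul, mul_neg_one]
      exact or_congr eq_comm Iff.rfl
    have e2 : (g⁻¹ * h * S = 1 ∨ g⁻¹ * h * S = -1) ↔ (h * S = g ∨ h * S = -g) := by
      rw [mul_assoc, inv_mul_eq_one, inv_mul_eq_iff_eq_mul, mul_neg_one]
      exact or_congr eq_comm Iff.rfl
    rw [hGdef, hGdef, ← mul_assoc, side_sub_side_mul_S (g⁻¹ * h), if_congr e1 rfl rfl, if_congr e2 rfl rfl]
  rw [e]
  exact key

end Acyclic

end Summit.BirchSwinnertonDyer.BirchSwinnertonDyer.Theorems.ThetaLayerLambdaCongruenceAtTwo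

end
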